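import Summits.SmoothPoincare4.SmoothPoincare4.Theses.CylinderEntropy
import Literature.Geometry.Riemannian.SphericalCylinderEntropy
import Literature.Geometry.Manifold.CylinderSlice

/-!
# Skeleton line `ball-mass-slack` for crux `ThinCrossSectionExists` (stmt-SmoothPoincare4-7633) — LEAD RESHAPE r1

Lead: prover-line-stmt-SmoothPoincare4-7633-0 (2026-08-16).  Planner skeleton (crux-plan, 4 stubs
`stub_harnackRadial` (A, XL), `stub_zonalMonotone` (B, L), `stub_layerCake` (C, L), `stub_massSlackIntr` (D, SPC4))
reshaped into SEVEN registered stubs with the SAME composition idea (`λ_cyl(S) ≤ m_N(S)·λ_cyl(slice₀)` by kernel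
domination + layer cake, supply `m_N < 4/e`), cut so that every provable piece is worker-sized and every deep piece is
an isolated, citable heat-kernel fact:

* `stub_hamiltonConvex` (H, DEEP — Hamilton 1993, matrix Harnack for the heat kernel of `S⁴`, radial form:
  `θ ↦ log 𝔥(τ, cos θ) + θ²/4τ` is convex along a great circle, and `𝔥 > 0`);
* `stub_harnackRadial_of_convex` (A', S — even convex functions are monotone on `[0, π]`: H ⇒ the planner's A);
* `stub_zonalMonotone` (B, DEEP — Cheeger–Yau 1981: the heat kernel of the round sphere is radially
  non-increasing; unchanged);
* `stub_kernelDomination` (C-dom, M — from A and B: an antitone non-negative radial profile `F` with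
  `K_{p,τ} ≤ F ∘ d_N(·,p)` on `N` and `ofReal F ∘ d_N(·,e₀) ≤ ofReal K_{e₀,τ}` on the slice);
* `stub_levelComparison` (C-level, M — ball-mass slack ⇒ superlevel-set slack: for antitone `F` the sets
  `{F ∘ d_N(·,p) > t}` are monotone limits of intrinsic balls);
* `stub_layerCakeCore` (C-core, M — `lintegral` layer cake: per-level slack ⇒ `F̂_{p,τ}(S) ≤ Λ·F̂_{e₀,τ}(slice₀)`);
* `stub_massSlackIntr` (D, OPEN — SPC4-strength supply, unchanged in content, held by the lead).

All seven signatures are written over Mathlib + `Literature.Geometry.Riemannian.SphericalCylinderEntropy`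
(`zonal`, `cylKernel`, `cylDensity`) ONLY (every set / distance / base point inlined exactly as below), so that each
stub lands as a pure-proof file under `Theorems/` and is glued here by name.  The §1 definitions are readability
aliases; `*_def` lemmas are `rfl`.

Composition `ThinCrossSectionExists_of : H → A' → B → C-dom → C-level → C-core → D → SliceCalibration → E`
is proved below (no `sorry` outside the seven `stub_*`).

## Disproof used (`Cruxes/ThinCrossSectionExists/Disproof.lean`, cdisprove cycle 2; `Negative/FrameAnalysis.lean` p72115)
`crux_iff_spc4` (E ⇔ SPC4 given R + calibration): D is where SPC4 lives (`massRigid`); `false_without_*`: the frame is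
used verbatim and only at D; `not_thinAtLevel_of_le_one`: D's `Λ ∈ [1, 4/e)`; `two_le_cylEntropy_twoSlices`: ball mass is
additive (two slices `Λ = 2`); `not_strongE`: D is an `∃`.  Nothing in the Disproof bears on H, A', B, C-* (kernel and
measure statements); `ledger negatives` for the crux: 0.
-/

noncomputable section

set_option linter.dupNamespace false
set_option linter.unusedVariables false

open scoped BigOperators Topology Manifold MeasureTheory ENNReal NNReal ContDiff ContinuousMap
open Set Function MeasureTheory
open Literature.Geometry.Riemannian.SphericalCylinderEntropy (cylEntropy cylDensity cylKernel zonal)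
open Literature.Geometry.Manifold.CylinderSlice (sliceMap range_sliceMap sum_sq_sliceMap
  isSmoothEmbedding_sliceMap separatesEnds_of_slice_subset)

namespace Summit.SmoothPoincare4.SmoothPoincare4.Cruxes.ThinCrossSectionExists.BallMassSlack

open Summit.SmoothPoincare4.SmoothPoincare4.Theses.CylinderEntropy (ThinCrossSectionExists
  CylinderRungTwo SliceCalibration)

local notation "E⁶" => EuclideanSpace ℝ (Fin 6)
local notation "E⁴" => EuclideanSpace ℝ (Fin 4)
local notation "𝕊⁴" => (Metric.sphere (0 : EuclideanSpace ℝ (Fin 5)) 1)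

/-! ## §0 The crux through named pieces (verbatim sub-expressions of the item) -/

/-- `z ∈ N = S⁴×ℝ ⊂ ℝ⁶`, literally as in the items. -/
def InN (z : E⁶) : Prop := ∑ i : Fin 5, z (Fin.castSucc i) ^ 2 = 1

/-- `N` as a set. -/
def cylN : Set E⁶ := {z | InN z}

/-- "separates the two ends of `N`", literally as in the items. -/
def Separates (A : Set E⁶) : Prop :=
  ∃ R : ℝ, ∀ a b : E⁶, InN a → InN b → a 5 ≤ -R → R ≤ b 5 → ¬ JoinedIn (cylN \ A) a b

/-- The unit slice `S⁴ × {0}` (the set of item 7634). -/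
def slice₀ : Set E⁶ := {z : E⁶ | ∑ i : Fin 5, z (Fin.castSucc i) ^ 2 = 1 ∧ z 5 = 0}

/-- The bubble-sheet threshold `4/e` as typed. -/
def level : ℝ≥0∞ := ENNReal.ofReal (4 / Real.exp 1)

/-- E's four conjuncts for a given `M` at threshold `c`. -/
def CrossSectionBelow (c : ℝ≥0∞) (M : Type) [TopologicalSpace M] [ChartedSpace E⁴ M] : Prop :=
  ∃ ι : M → E⁶, Manifold.IsSmoothEmbedding (𝓡 4) (𝓡 6) ∞ ι ∧ (∀ x, InN (ι x)) ∧
    Separates (Set.range ι) ∧ cylEntropy (Set.range ι) < c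

/-- The crux is literally `∀` homotopy 4-spheres, `CrossSectionBelow level` (definitional unfolding only). -/
theorem crux_iff :
    ThinCrossSectionExists ↔
      ∀ (M : Type) [TopologicalSpace M] [T2Space M] [SecondCountableTopology M]
        [ChartedSpace E⁴ M] [IsManifold (𝓡 4) ∞ M], M ≃ₕ 𝕊⁴ → CrossSectionBelow level M :=
  Iff.rfl

/-- The support item `SliceCalibration` (7634) is literally `λ_cyl(slice₀) = 1`. -/
theorem sliceCalibration_iff : SliceCalibration ↔ cylEntropy slice₀ = 1 := Iff.rfl

/-! ## §1 Intrinsic balls of `N` and subspherical ball mass (readability aliases of the inlined expressions) -/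

/-- Reference point `e₀ = (1,0,0,0,0,0)` on the slice. -/
def e₀ : E⁶ := EuclideanSpace.single 0 1

theorem inN_e₀ : InN e₀ := by
  unfold InN e₀
  rw [Finset.sum_eq_single (0 : Fin 5)]
  · simp
  · intro i _ hi
    have : (Fin.castSucc i : Fin 6) ≠ 0 := fun h => hi (Fin.castSucc_eq_zero_iff.1 h)
    simp [this]
  · simp

theorem e₀_apply_five : e₀ 5 = 0 := by
  simp [e₀]

/-- Product (intrinsic) distance on `N = S⁴ × ℝ`: `d_N(y,p) = √(arccos⟨y',p'⟩² + (y₅ - p₅)²)`. -/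
def dN (y p : E⁶) : ℝ :=
  Real.sqrt (Real.arccos (∑ i : Fin 5, y (Fin.castSucc i) * p (Fin.castSucc i)) ^ 2 + (y 5 - p 5) ^ 2)

/-- Closed intrinsic ball of `N` around `p`, radius `r`. -/
def intrBall (p : E⁶) (r : ℝ) : Set E⁶ :=
  {y : E⁶ | ∑ i : Fin 5, y (Fin.castSucc i) ^ 2 = 1 ∧
    Real.arccos (∑ i : Fin 5, y (Fin.castSucc i) * p (Fin.castSucc i)) ^ 2 + (y 5 - p 5) ^ 2 ≤ r ^ 2}

/-- **`Λ`-subspherical intrinsic ball mass** (inlined form = the registered text). -/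
def SubsphericalMassIntr (Λ : ℝ≥0∞) (S : Set E⁶) : Prop :=
  ∀ p : E⁶, InN p → ∀ r : ℝ, 0 < r → μH[4] (S ∩ intrBall p r) ≤ Λ * μH[4] (slice₀ ∩ intrBall e₀ r)

/-! ## §2 The seven registered stubs (signatures over Mathlib + `zonal` / `cylKernel` / `cylDensity` only) -/
/-- STUB H (`stub_hamiltonConvex`; DEEP, TRUE — cited).  For every `τ > 0` the typed zonal kernel
`𝔥(τ,·) = zonal τ` of `S⁴` is positive along every great circle and `θ ↦ log 𝔥(τ, cos θ) + θ²/(4τ)` is convex on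
`[-π, π]`.  WHY TRUE: `𝔥(τ, cos θ) = vol(S⁴)·H(τ, γ(θ), p')` for a unit-speed great circle `γ` through `p'`
(zonal expansion of the heat kernel of `S⁴`: eigenvalues `k(k+3)`, zonal harmonics `(2k+3)/3·C_k^{(3/2)}`); `H > 0`
(strict positivity of the heat kernel of a closed manifold) and Hamilton's matrix Harnack estimate
`∇²log H + g/(2τ) ≥ 0` (compact, `sec ≥ 0`, `∇Ric = 0`; R. S. Hamilton, Comm. Anal. Geom. 1 (1993) 113–126,
Thm 1.1 / Cor. 1.2) give `(log H∘γ)'' ≥ -1/(2τ)` on `ℝ`, i.e. convexity of `log 𝔥(τ, cos θ) + θ²/4τ`.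
NUMERICS: three triage seats + planner, 0 violations (`min (2τ f'' + 1) ≈ τ(1 - O(τ)) > 0`).  In Lean this is a
named Literature fact to be discharged by a literature-prover (maximum principle for Hamilton's quantity on `S⁴`);
the lead files it as `[cite]` fact.  Leans on: tree `zonal`; Mathlib `ConvexOn`, `Real.log`, `Real.cos`. -/
theorem stub_hamiltonConvex :
    ∀ τ : ℝ, 0 < τ →
        (∀ θ : ℝ, 0 < zonal τ (Real.cos θ)) ∧
          ConvexOn ℝ (Set.Icc (-Real.pi) Real.pi)
            (fun θ : ℝ => Real.log (zonal τ (Real.cos θ)) + θ ^ 2 / (4 * τ)) := by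
  sorry

/-- STUB A' (`stub_harnackRadial_of_convex`; size S, pure convexity).  H ⇒ the planner's STUB A: for `τ > 0`,
`θ ↦ 𝔥(τ, cos θ)·e^{θ²/4τ}` is non-decreasing on `[0, π]`.  PROOF: `φ(θ) = log 𝔥(τ, cos θ) + θ²/4τ` is convex on
`[-π, π]` and EVEN (`cos` even), hence `φ(0) ≤ (φ(θ) + φ(-θ))/2 = φ(θ)`, so `φ` is minimised at `0`; a convex
function minimised at the left end of `[0, π]` is non-decreasing there (three-slope inequality,
`ConvexOn.slope_mono_adjacent` / `ConvexOn.monotoneOn_of_…`); exponentiate (`𝔥 > 0`):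
`𝔥(τ,cos θ) e^{θ²/4τ} = exp φ(θ)`.  Leans on: Mathlib `ConvexOn`, `Real.exp_log`, `Real.exp_monotone`. -/
theorem stub_harnackRadial_of_convex :
    (∀ τ : ℝ, 0 < τ →
        (∀ θ : ℝ, 0 < zonal τ (Real.cos θ)) ∧
          ConvexOn ℝ (Set.Icc (-Real.pi) Real.pi)
            (fun θ : ℝ => Real.log (zonal τ (Real.cos θ)) + θ ^ 2 / (4 * τ))) →
      ∀ τ : ℝ, 0 < τ →
        MonotoneOn (fun θ : ℝ => zonal τ (Real.cos θ) * Real.exp (θ ^ 2 / (4 * τ))) (Set.Icc 0 Real.pi) := by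
  sorry

/-- STUB B (`stub_zonalMonotone`; DEEP, TRUE — cited; unchanged from the planner's skeleton).  For `τ > 0`,
`s ↦ 𝔥(τ, s)` is non-decreasing on `[-1, 1]`: the heat kernel of the round `S⁴` is a non-increasing function of
the geodesic distance `arccos s`.  WHY TRUE: J. Cheeger, S.-T. Yau, Comm. Pure Appl. Math. 34 (1981) 465–480
(the heat kernel of a simply connected space form is radially non-increasing — the lemma behind their comparison
theorem); equivalently `∂_s 𝔥_{S⁴} = 5e^{-4τ} 𝔥_{S⁶} > 0` (positivity of the heat kernel of `S⁶`).  Numerics: 0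
violations (all seats).  Named Literature fact; dischargeable in Lean by the energy method of
`Literature.Analysis.SpecialFunctions.JacobiHeatPositivity` (positivity preservation for the ultraspherical heat
flow) + polynomial approximation of the delta.  Leans on: tree `zonal`; Mathlib `MonotoneOn`. -/
theorem stub_zonalMonotone :
    ∀ τ : ℝ, 0 < τ → MonotoneOn (zonal τ) (Set.Icc (-1) 1) := by
  sorry

/-- STUB C-dom (`stub_kernelDomination`; size M, real analysis).  From A and B: for every `τ > 0` there is a
profile `F : ℝ → ℝ`, antitone and non-negative, with (domination) `K_{p,τ}(y) ≤ F(d_N(y,p))` for all `p, y ∈ N` and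
(exactness on the slice, through `ofReal`) `ofReal (F (d_N(y,e₀))) ≤ ofReal (K_{e₀,τ}(y))` for `y ∈ slice₀`, where
`K_{p,τ}(y) = cylKernel p τ y = 𝔥(τ,⟨y',p'⟩)·e^{-(y₅-p₅)²/4τ}` (`cylKernel_eq`), `d_N(y,p) = √(arccos⟨y',p'⟩² + (y₅-p₅)²)`,
`e₀ = EuclideanSpace.single 0 1`.  PROOF: take `F r := max 0 (g r)` extended by `F r := F 0` for `r < 0`, where
`g r := 𝔥(τ, cos θ*)·e^{(θ*² - r²)/4τ}`, `θ* := min r π`.  Domination: with `θ := arccos⟨y',p'⟩ ∈ [0,π]`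
(`|⟨y',p'⟩| ≤ 1`, tree `abs_sum_mul_le_one`, `Real.cos_arccos`), `r := d_N ≥ θ`, `θ ≤ θ* ≤ π`, A gives
`𝔥(τ,cos θ)e^{θ²/4τ} ≤ 𝔥(τ,cos θ*)e^{θ*²/4τ}`, multiply by `e^{-r²/4τ}` and use `θ² + (y₅-p₅)² = r²`.  Exactness: on the
slice `y₅ = 0 = (e₀)₅`, `r = θ ≤ π`, `g(r) = 𝔥(τ, cos(arccos y₀)) = K_{e₀,τ}(y)` and `ofReal (max 0 g) = ofReal g`.
Antitone: on `[0,π]` by B (`cos` antitone there, `𝔥(τ,·)` monotone on `[-1,1]`); on `[π,∞)` `g = 𝔥(τ,-1)e^{(π²-r²)/4τ}`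
is antitone if `𝔥(τ,-1) ≥ 0` and `max 0 g ≡ 0` there otherwise — in both cases `max 0 g` is antitone on `[0,∞)`
(no positivity of `𝔥` is assumed).  Leans on: tree `cylKernel_eq`, `abs_sum_mul_le_one`; Mathlib `Real.arccos_le_pi`,
`Real.arccos_nonneg`, `Real.cos_arccos`, `Real.strictAntiOn_cos`/`Real.antitoneOn_cos`... , `Real.sqrt_le_sqrt`,
`Real.sq_sqrt`, `Antitone`. -/
theorem stub_kernelDomination :
    (∀ τ : ℝ, 0 < τ →
        MonotoneOn (fun θ : ℝ => zonal τ (Real.cos θ) * Real.exp (θ ^ 2 / (4 * τ))) (Set.Icc 0 Real.pi)) →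
    (∀ τ : ℝ, 0 < τ → MonotoneOn (zonal τ) (Set.Icc (-1) 1)) →
      ∀ τ : ℝ, 0 < τ → ∃ F : ℝ → ℝ, Antitone F ∧ (∀ r : ℝ, 0 ≤ F r) ∧
        (∀ p y : EuclideanSpace ℝ (Fin 6), ∑ i : Fin 5, p (Fin.castSucc i) ^ 2 = 1 → ∑ i : Fin 5, y (Fin.castSucc i) ^ 2 = 1 →
            cylKernel p τ y ≤ F (Real.sqrt (Real.arccos (∑ i : Fin 5, y (Fin.castSucc i) * p (Fin.castSucc i)) ^ 2 + (y 5 - p 5) ^ 2))) ∧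
        (∀ y : EuclideanSpace ℝ (Fin 6), ∑ i : Fin 5, y (Fin.castSucc i) ^ 2 = 1 → y 5 = 0 →
            ENNReal.ofReal (F (Real.sqrt (Real.arccos (∑ i : Fin 5, y (Fin.castSucc i) * (EuclideanSpace.single 0 1 : EuclideanSpace ℝ (Fin 6)) (Fin.castSucc i)) ^ 2 + (y 5 - (EuclideanSpace.single 0 1 : EuclideanSpace ℝ (Fin 6)) 5) ^ 2))) ≤
              ENNReal.ofReal (cylKernel (EuclideanSpace.single 0 1 : EuclideanSpace ℝ (Fin 6)) τ y)) := by
  sorry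

/-- STUB C-level (`stub_levelComparison`; size M, measure theory).  BALL-MASS SLACK ⇒ LEVEL-SET SLACK: if
`S ⊆ N` has `Λ`-subspherical intrinsic ball mass (`μH⁴(S ∩ B̄ᴺ(q,r)) ≤ Λ·μH⁴(slice₀ ∩ B̄ᴺ(e₀,r))` for all `q ∈ N`,
`r > 0`) and `F : ℝ → ℝ` is antitone, then for every centre `p ∈ N` and level `t`,
`μH⁴(S ∩ {F(d_N(·,p)) > t}) ≤ Λ·μH⁴(slice₀ ∩ {F(d_N(·,e₀)) > t})`.  PROOF: `I_t := {r | t < F r}` is a lower set of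
`ℝ` (F antitone), so `I_t ∩ [0,∞)` is `∅`, `[0,∞)`, `[0,R]` or `[0,R)` (`R = sSup`, `0 ≤ R < ∞`), and
`y ∈ {F∘d_N > t} ↔ d_N(y,·) ∈ I_t` (`d_N ≥ 0`).  Case `∅`: both sides `0`.  Case `[0,∞)`: `S ∩ N = ⋃_n (S ∩ B̄ᴺ(p,n+1))`
increasing, `measure_iUnion_eq_iSup`/`Monotone.measure_iUnion`, each term `≤ Λ·μH⁴(slice₀ ∩ B̄ᴺ(e₀,n+1)) ≤ Λ·μH⁴(slice₀)`.
Case `[0,R]`, `R > 0`: the sets ARE `S ∩ B̄ᴺ(p,R)` and `slice₀ ∩ B̄ᴺ(e₀,R)` (`√a ≤ R ↔ a ≤ R²`, `Real.sqrt_le_left` /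
`Real.sqrt_le_sqrt`, `Real.le_sqrt`), hypothesis at `r = R`.  Case `[0,R]`, `R = 0`: `{y ∈ N | d_N(y,p) ≤ 0} ⊆ {p}`
(`arccos⟨y',p'⟩ = 0 ⇒ ⟨y',p'⟩ ≥ 1 ⇒ y' = p'` for unit vectors, and `y₅ = p₅`), and `μH[4] {p} = 0`
(`MeasureTheory.Measure.noAtoms_hausdorff`).  Case `[0,R)`, `R > 0`: `{d_N < R} = ⋃_n B̄ᴺ(·, R·(n+1)/(n+2))` increasing;
continuity from below on the `S` side, monotonicity on the slice side.  Leans on: Mathlib `measure_iUnion_eq_iSup`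
(or `MeasureTheory.tendsto_measure_iUnion_atTop`), `measure_mono`, `Real.sqrt_lt'`, `Real.sqrt_le'`,
`Real.arccos_nonneg`, `Real.arccos_eq_zero`, `Measure.noAtoms_hausdorff`, `Set.Subsingleton.measure_zero`. -/
theorem stub_levelComparison :
    ∀ (Λ : ℝ≥0∞) (S : Set (EuclideanSpace ℝ (Fin 6))) (F : ℝ → ℝ) (p : EuclideanSpace ℝ (Fin 6)) (t : ℝ),
      (∀ y ∈ S, ∑ i : Fin 5, y (Fin.castSucc i) ^ 2 = 1) →
      (∀ p : EuclideanSpace ℝ (Fin 6), ∑ i : Fin 5, p (Fin.castSucc i) ^ 2 = 1 → ∀ r : ℝ, 0 < r →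
          μH[4] (S ∩ {y : EuclideanSpace ℝ (Fin 6) | ∑ i : Fin 5, y (Fin.castSucc i) ^ 2 = 1 ∧ Real.arccos (∑ i : Fin 5, y (Fin.castSucc i) * p (Fin.castSucc i)) ^ 2 + (y 5 - p 5) ^ 2 ≤ r ^ 2}) ≤
            Λ * μH[4] ({z : EuclideanSpace ℝ (Fin 6) | ∑ i : Fin 5, z (Fin.castSucc i) ^ 2 = 1 ∧ z 5 = 0} ∩
              {y : EuclideanSpace ℝ (Fin 6) | ∑ i : Fin 5, y (Fin.castSucc i) ^ 2 = 1 ∧ Real.arccos (∑ i : Fin 5, y (Fin.castSucc i) * (EuclideanSpace.single 0 1 : EuclideanSpace ℝ (Fin 6)) (Fin.castSucc i)) ^ 2 + (y 5 - (EuclideanSpace.single 0 1 : EuclideanSpace ℝ (Fin 6)) 5) ^ 2 ≤ r ^ 2})) →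
      Antitone F → ∑ i : Fin 5, p (Fin.castSucc i) ^ 2 = 1 →
        μH[4] (S ∩ {y : EuclideanSpace ℝ (Fin 6) | t < F (Real.sqrt (Real.arccos (∑ i : Fin 5, y (Fin.castSucc i) * p (Fin.castSucc i)) ^ 2 + (y 5 - p 5) ^ 2))}) ≤
            Λ * μH[4] ({z : EuclideanSpace ℝ (Fin 6) | ∑ i : Fin 5, z (Fin.castSucc i) ^ 2 = 1 ∧ z 5 = 0} ∩ {y : EuclideanSpace ℝ (Fin 6) | t < F (Real.sqrt (Real.arccos (∑ i : Fin 5, y (Fin.castSucc i) * (EuclideanSpace.single 0 1 : EuclideanSpace ℝ (Fin 6)) (Fin.castSucc i)) ^ 2 + (y 5 - (EuclideanSpace.single 0 1 : EuclideanSpace ℝ (Fin 6)) 5) ^ 2))}) := by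
  sorry

/-- STUB C-core (`stub_layerCakeCore`; size M, measure theory — the `lintegral` layer cake).  Given `S ⊆ N`, a
centre `p ∈ N`, a scale `τ`, an antitone non-negative profile `F` dominating the kernel on `N`
(`K_{p,τ} ≤ F∘d_N(·,p)`) and dominated by it on the slice through `ofReal` (`ofReal F∘d_N(·,e₀) ≤ ofReal K_{e₀,τ}` on
`slice₀`), the per-level slack `μH⁴(S ∩ {F∘d_N(·,p) > t}) ≤ Λ·μH⁴(slice₀ ∩ {F∘d_N(·,e₀) > t})` for all `t > 0` integrates to
`F̂_{p,τ}(S) ≤ Λ·F̂_{e₀,τ}(slice₀)` (typed `cylDensity`; the common factor `μH⁴(S⁴)⁻¹` cancels).  PROOF: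
`cylDensity S p τ = c⁻¹ ∫⁻ y in S, ofReal (K y)`; (1) `ofReal K ≤ G` everywhere with `G y := if y ∈ N then ofReal (F (d_N y p)) else ⊤`
(`lintegral_mono`), and `G = ofReal ∘ F ∘ d_N` `(μH⁴.restrict S)`-a.e. because `(μH⁴.restrict S) Nᶜ = μH⁴(Nᶜ ∩ S) = 0`
(`Measure.restrict_apply` with the MEASURABLE test set `Nᶜ`; `S` itself need not be measurable); (2) layer cake
`MeasureTheory.lintegral_eq_lintegral_meas_lt` for the real function `F ∘ d_N(·,p)` (non-negative; measurable:
`Antitone.measurable` and continuity of `y ↦ √(arccos⟨y',p'⟩² + (y₅-p₅)²)`, `Real.continuous_arccos`), giving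
`∫⁻ t in Ioi 0, (μH⁴.restrict S) {t < F∘d_N}` and `Measure.restrict_apply` (measurable level sets); (3) the per-level
hypothesis and `lintegral_const_mul` / `lintegral_mono` (`t ↦ μ(slice₀ ∩ {t < F∘d})` is antitone hence measurable);
(4) layer cake backwards on `slice₀` (measurable: `measurableSet_range_sliceMap 0` + `range_sliceMap 0`) and the
exactness hypothesis with `setLIntegral_mono'`; (5) multiply by `c⁻¹ = (μH⁴ S⁴)⁻¹` (`mul_left_comm`, `mul_le_mul_left'`).
Leans on: tree `cylDensity`, `range_sliceMap`, `measurableSet_range_sliceMap`; Mathlib `lintegral_eq_lintegral_meas_lt`,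
`Measure.restrict_apply`, `lintegral_mono`, `lintegral_congr_ae`, `lintegral_const_mul`, `setLIntegral_mono'`. -/
theorem stub_layerCakeCore :
    ∀ (τ : ℝ) (Λ : ℝ≥0∞) (S : Set (EuclideanSpace ℝ (Fin 6))) (F : ℝ → ℝ) (p : EuclideanSpace ℝ (Fin 6)),
      (∀ y ∈ S, ∑ i : Fin 5, y (Fin.castSucc i) ^ 2 = 1) →
      Antitone F → (∀ r : ℝ, 0 ≤ F r) → ∑ i : Fin 5, p (Fin.castSucc i) ^ 2 = 1 →
      (∀ y : EuclideanSpace ℝ (Fin 6), ∑ i : Fin 5, y (Fin.castSucc i) ^ 2 = 1 → cylKernel p τ y ≤ F (Real.sqrt (Real.arccos (∑ i : Fin 5, y (Fin.castSucc i) * p (Fin.castSucc i)) ^ 2 + (y 5 - p 5) ^ 2))) →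
      (∀ y : EuclideanSpace ℝ (Fin 6), ∑ i : Fin 5, y (Fin.castSucc i) ^ 2 = 1 → y 5 = 0 →
            ENNReal.ofReal (F (Real.sqrt (Real.arccos (∑ i : Fin 5, y (Fin.castSucc i) * (EuclideanSpace.single 0 1 : EuclideanSpace ℝ (Fin 6)) (Fin.castSucc i)) ^ 2 + (y 5 - (EuclideanSpace.single 0 1 : EuclideanSpace ℝ (Fin 6)) 5) ^ 2))) ≤
              ENNReal.ofReal (cylKernel (EuclideanSpace.single 0 1 : EuclideanSpace ℝ (Fin 6)) τ y)) →
      (∀ t : ℝ, 0 < t →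
          μH[4] (S ∩ {y : EuclideanSpace ℝ (Fin 6) | t < F (Real.sqrt (Real.arccos (∑ i : Fin 5, y (Fin.castSucc i) * p (Fin.castSucc i)) ^ 2 + (y 5 - p 5) ^ 2))}) ≤
            Λ * μH[4] ({z : EuclideanSpace ℝ (Fin 6) | ∑ i : Fin 5, z (Fin.castSucc i) ^ 2 = 1 ∧ z 5 = 0} ∩ {y : EuclideanSpace ℝ (Fin 6) | t < F (Real.sqrt (Real.arccos (∑ i : Fin 5, y (Fin.castSucc i) * (EuclideanSpace.single 0 1 : EuclideanSpace ℝ (Fin 6)) (Fin.castSucc i)) ^ 2 + (y 5 - (EuclideanSpace.single 0 1 : EuclideanSpace ℝ (Fin 6)) 5) ^ 2))})) →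
        cylDensity S p τ ≤ Λ * cylDensity {z : EuclideanSpace ℝ (Fin 6) | ∑ i : Fin 5, z (Fin.castSucc i) ^ 2 = 1 ∧ z 5 = 0} (EuclideanSpace.single 0 1 : EuclideanSpace ℝ (Fin 6)) τ := by
  sorry

/-- STUB D (`stub_massSlackIntr`; OPEN — SPC4-strength, the HARDEST stub and the line's conjecture; content unchanged
from the planner's skeleton, vocabulary inlined).  Every homotopy 4-sphere `M` (bare summit frame) has a smooth
embedding `ι : M → ℝ⁶` into `N`, separating the two ends, and a `Λ < 4/e` with `Λ`-subspherical intrinsic ball mass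
of its image.  WHY IT MIGHT BE TRUE / FAIL: implied by SPC4 (the slice through a diffeomorphism has `Λ = 1`: an
off-slice intrinsic ball meets the slice in a cap of radius `√(r² - h²) ≤ r`, lead's support lemma
`subsphericalMassIntr_one_slice₀`); with H, A', B, C-* , the calibration item and the sibling crux R it implies
`M ≅ S⁴` (`massRigid`), so given R it is FALSE for an exotic `M` — it is E's SPC4 content in ball-count form
(`Disproof.crux_iff_spc4`).  No mechanism for a sphere not already known standard is claimed (card §Transfer,
triage r2-2); the lead holds this stub as the structure/refutation target.  Leans on: frame only. -/
theorem stub_massSlackIntr :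
    ∀ (M : Type) [TopologicalSpace M] [T2Space M] [SecondCountableTopology M]
      [ChartedSpace (EuclideanSpace ℝ (Fin 4)) M] [IsManifold (𝓡 4) ∞ M],
      M ≃ₕ (Metric.sphere (0 : EuclideanSpace ℝ (Fin 5)) 1) →
      ∃ ι : M → EuclideanSpace ℝ (Fin 6), Manifold.IsSmoothEmbedding (𝓡 4) (𝓡 6) ∞ ι ∧
        (∀ x, ∑ i : Fin 5, ι x (Fin.castSucc i) ^ 2 = 1) ∧
        (∃ R : ℝ, ∀ a b : EuclideanSpace ℝ (Fin 6), ∑ i : Fin 5, a (Fin.castSucc i) ^ 2 = 1 → ∑ i : Fin 5, b (Fin.castSucc i) ^ 2 = 1 → a 5 ≤ -R → R ≤ b 5 →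
          ¬ JoinedIn ({z : EuclideanSpace ℝ (Fin 6) | ∑ i : Fin 5, z (Fin.castSucc i) ^ 2 = 1} \ Set.range ι) a b) ∧
        ∃ Λ : ℝ≥0∞, Λ < ENNReal.ofReal (4 / Real.exp 1) ∧
          ∀ p : EuclideanSpace ℝ (Fin 6), ∑ i : Fin 5, p (Fin.castSucc i) ^ 2 = 1 → ∀ r : ℝ, 0 < r →
          μH[4] (Set.range ι ∩ {y : EuclideanSpace ℝ (Fin 6) | ∑ i : Fin 5, y (Fin.castSucc i) ^ 2 = 1 ∧ Real.arccos (∑ i : Fin 5, y (Fin.castSucc i) * p (Fin.castSucc i)) ^ 2 + (y 5 - p 5) ^ 2 ≤ r ^ 2}) ≤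
            Λ * μH[4] ({z : EuclideanSpace ℝ (Fin 6) | ∑ i : Fin 5, z (Fin.castSucc i) ^ 2 = 1 ∧ z 5 = 0} ∩
              {y : EuclideanSpace ℝ (Fin 6) | ∑ i : Fin 5, y (Fin.castSucc i) ^ 2 = 1 ∧ Real.arccos (∑ i : Fin 5, y (Fin.castSucc i) * (EuclideanSpace.single 0 1 : EuclideanSpace ℝ (Fin 6)) (Fin.castSucc i)) ^ 2 + (y 5 - (EuclideanSpace.single 0 1 : EuclideanSpace ℝ (Fin 6)) 5) ^ 2 ≤ r ^ 2}) := by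
  sorry

/-! ## §3 Glue (proved): the seven stubs and the calibration item give the crux -/

/-- The named statement of STUB A (planner's `HarnackRadial`), now DERIVED from H by A'. -/
def HarnackRadial : Prop :=
  ∀ τ : ℝ, 0 < τ →
        MonotoneOn (fun θ : ℝ => zonal τ (Real.cos θ) * Real.exp (θ ^ 2 / (4 * τ))) (Set.Icc 0 Real.pi)

/-- The named statement of STUB B. -/
def ZonalMonotone : Prop := ∀ τ : ℝ, 0 < τ → MonotoneOn (zonal τ) (Set.Icc (-1) 1)

theorem harnackRadial_holds : HarnackRadial := stub_harnackRadial_of_convex stub_hamiltonConvex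
theorem zonalMonotone_holds : ZonalMonotone := stub_zonalMonotone

/-- `SubsphericalMassIntr` is the inlined registered text (definitional). -/
theorem subsphericalMassIntr_iff (Λ : ℝ≥0∞) (S : Set E⁶) :
    SubsphericalMassIntr Λ S ↔
      ∀ p : EuclideanSpace ℝ (Fin 6), ∑ i : Fin 5, p (Fin.castSucc i) ^ 2 = 1 → ∀ r : ℝ, 0 < r →
          μH[4] (S ∩ {y : EuclideanSpace ℝ (Fin 6) | ∑ i : Fin 5, y (Fin.castSucc i) ^ 2 = 1 ∧ Real.arccos (∑ i : Fin 5, y (Fin.castSucc i) * p (Fin.castSucc i)) ^ 2 + (y 5 - p 5) ^ 2 ≤ r ^ 2}) ≤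
            Λ * μH[4] ({z : EuclideanSpace ℝ (Fin 6) | ∑ i : Fin 5, z (Fin.castSucc i) ^ 2 = 1 ∧ z 5 = 0} ∩
              {y : EuclideanSpace ℝ (Fin 6) | ∑ i : Fin 5, y (Fin.castSucc i) ^ 2 = 1 ∧ Real.arccos (∑ i : Fin 5, y (Fin.castSucc i) * (EuclideanSpace.single 0 1 : EuclideanSpace ℝ (Fin 6)) (Fin.castSucc i)) ^ 2 + (y 5 - (EuclideanSpace.single 0 1 : EuclideanSpace ℝ (Fin 6)) 5) ^ 2 ≤ r ^ 2}) :=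
  Iff.rfl

/-- **The lever, relative form at one centre and scale** (C-dom + C-level + C-core from A and B): a set `S ⊆ N`
with `Λ`-subspherical intrinsic ball mass has `F̂_{p,τ}(S) ≤ Λ·F̂_{e₀,τ}(slice₀)` for every `p ∈ N`, `τ > 0`. -/
theorem cylDensity_le_of_subspherical (hA : HarnackRadial) (hB : ZonalMonotone) {Λ : ℝ≥0∞} {S : Set E⁶}
    (hS : ∀ y ∈ S, InN y) (hm : SubsphericalMassIntr Λ S) {p : E⁶} (hp : InN p) {τ : ℝ} (hτ : 0 < τ) :
    cylDensity S p τ ≤ Λ * cylDensity slice₀ e₀ τ := by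
  obtain ⟨F, hFa, hF0, hdom, hex⟩ := stub_kernelDomination hA hB τ hτ
  exact stub_layerCakeCore τ Λ S F p hS hFa hF0 hp (fun y hy => hdom p y hp hy) hex
    (fun t _ => stub_levelComparison Λ S F p t hS hm hFa hp)

/-- **The lever, absolute form** (+ the calibration item 7634): `λ_cyl(S) ≤ Λ`. -/
theorem cylEntropy_le_of_subspherical (hA : HarnackRadial) (hB : ZonalMonotone) (hcal : SliceCalibration)
    {Λ : ℝ≥0∞} {S : Set E⁶} (hS : ∀ y ∈ S, InN y) (hm : SubsphericalMassIntr Λ S) : cylEntropy S ≤ Λ := by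
  have h1 : cylEntropy slice₀ = 1 := sliceCalibration_iff.mp hcal
  show (⨆ (p : E⁶) (_ : ∑ i : Fin 5, p (Fin.castSucc i) ^ 2 = 1) (τ : ℝ) (_ : 0 < τ),
    cylDensity S p τ) ≤ Λ
  refine iSup₂_le fun p hp => iSup₂_le fun τ hτ => ?_
  calc cylDensity S p τ ≤ Λ * cylDensity slice₀ e₀ τ := cylDensity_le_of_subspherical hA hB hS hm hp hτ
    _ ≤ Λ * cylEntropy slice₀ := by
        gcongr
        exact le_iSup_of_le e₀ (le_iSup_of_le inN_e₀ (le_iSup_of_le τ (le_iSup_of_le hτ le_rfl)))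
    _ = Λ := by rw [h1, mul_one]

/-- Strict form used by the composition. -/
theorem cylEntropy_lt_level_of_subspherical (hA : HarnackRadial) (hB : ZonalMonotone) (hcal : SliceCalibration)
    {Λ : ℝ≥0∞} (hΛ : Λ < level) {S : Set E⁶} (hS : ∀ y ∈ S, InN y) (hm : SubsphericalMassIntr Λ S) :
    cylEntropy S < level :=
  lt_of_le_of_lt (cylEntropy_le_of_subspherical hA hB hcal hS hm) hΛ

/-! ### Name-keyed aliases of the seven statements (the hypotheses of the composition) -/
namespace Registered

/-- Alias keyed by the registered stub name. -/
abbrev stub_hamiltonConvex : Prop :=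
  ∀ τ : ℝ, 0 < τ →
        (∀ θ : ℝ, 0 < zonal τ (Real.cos θ)) ∧
          ConvexOn ℝ (Set.Icc (-Real.pi) Real.pi)
            (fun θ : ℝ => Real.log (zonal τ (Real.cos θ)) + θ ^ 2 / (4 * τ))
/-- Alias keyed by the registered stub name. -/
abbrev stub_harnackRadial_of_convex : Prop :=
  (∀ τ : ℝ, 0 < τ →
        (∀ θ : ℝ, 0 < zonal τ (Real.cos θ)) ∧
          ConvexOn ℝ (Set.Icc (-Real.pi) Real.pi)
            (fun θ : ℝ => Real.log (zonal τ (Real.cos θ)) + θ ^ 2 / (4 * τ))) →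
      ∀ τ : ℝ, 0 < τ →
        MonotoneOn (fun θ : ℝ => zonal τ (Real.cos θ) * Real.exp (θ ^ 2 / (4 * τ))) (Set.Icc 0 Real.pi)
/-- Alias keyed by the registered stub name. -/
abbrev stub_zonalMonotone : Prop := ∀ τ : ℝ, 0 < τ → MonotoneOn (zonal τ) (Set.Icc (-1) 1)
/-- Alias keyed by the registered stub name. -/
abbrev stub_kernelDomination : Prop :=
    (∀ τ : ℝ, 0 < τ →
        MonotoneOn (fun θ : ℝ => zonal τ (Real.cos θ) * Real.exp (θ ^ 2 / (4 * τ))) (Set.Icc 0 Real.pi)) →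
    (∀ τ : ℝ, 0 < τ → MonotoneOn (zonal τ) (Set.Icc (-1) 1)) →
      ∀ τ : ℝ, 0 < τ → ∃ F : ℝ → ℝ, Antitone F ∧ (∀ r : ℝ, 0 ≤ F r) ∧
        (∀ p y : EuclideanSpace ℝ (Fin 6), ∑ i : Fin 5, p (Fin.castSucc i) ^ 2 = 1 → ∑ i : Fin 5, y (Fin.castSucc i) ^ 2 = 1 →
            cylKernel p τ y ≤ F (Real.sqrt (Real.arccos (∑ i : Fin 5, y (Fin.castSucc i) * p (Fin.castSucc i)) ^ 2 + (y 5 - p 5) ^ 2))) ∧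
        (∀ y : EuclideanSpace ℝ (Fin 6), ∑ i : Fin 5, y (Fin.castSucc i) ^ 2 = 1 → y 5 = 0 →
            ENNReal.ofReal (F (Real.sqrt (Real.arccos (∑ i : Fin 5, y (Fin.castSucc i) * (EuclideanSpace.single 0 1 : EuclideanSpace ℝ (Fin 6)) (Fin.castSucc i)) ^ 2 + (y 5 - (EuclideanSpace.single 0 1 : EuclideanSpace ℝ (Fin 6)) 5) ^ 2))) ≤
              ENNReal.ofReal (cylKernel (EuclideanSpace.single 0 1 : EuclideanSpace ℝ (Fin 6)) τ y))
/-- Alias keyed by the registered stub name. -/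
abbrev stub_levelComparison : Prop :=
    ∀ (Λ : ℝ≥0∞) (S : Set (EuclideanSpace ℝ (Fin 6))) (F : ℝ → ℝ) (p : EuclideanSpace ℝ (Fin 6)) (t : ℝ),
      (∀ y ∈ S, ∑ i : Fin 5, y (Fin.castSucc i) ^ 2 = 1) →
      (∀ p : EuclideanSpace ℝ (Fin 6), ∑ i : Fin 5, p (Fin.castSucc i) ^ 2 = 1 → ∀ r : ℝ, 0 < r →
          μH[4] (S ∩ {y : EuclideanSpace ℝ (Fin 6) | ∑ i : Fin 5, y (Fin.castSucc i) ^ 2 = 1 ∧ Real.arccos (∑ i : Fin 5, y (Fin.castSucc i) * p (Fin.castSucc i)) ^ 2 + (y 5 - p 5) ^ 2 ≤ r ^ 2}) ≤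
            Λ * μH[4] ({z : EuclideanSpace ℝ (Fin 6) | ∑ i : Fin 5, z (Fin.castSucc i) ^ 2 = 1 ∧ z 5 = 0} ∩
              {y : EuclideanSpace ℝ (Fin 6) | ∑ i : Fin 5, y (Fin.castSucc i) ^ 2 = 1 ∧ Real.arccos (∑ i : Fin 5, y (Fin.castSucc i) * (EuclideanSpace.single 0 1 : EuclideanSpace ℝ (Fin 6)) (Fin.castSucc i)) ^ 2 + (y 5 - (EuclideanSpace.single 0 1 : EuclideanSpace ℝ (Fin 6)) 5) ^ 2 ≤ r ^ 2})) →
      Antitone F → ∑ i : Fin 5, p (Fin.castSucc i) ^ 2 = 1 →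
        μH[4] (S ∩ {y : EuclideanSpace ℝ (Fin 6) | t < F (Real.sqrt (Real.arccos (∑ i : Fin 5, y (Fin.castSucc i) * p (Fin.castSucc i)) ^ 2 + (y 5 - p 5) ^ 2))}) ≤
            Λ * μH[4] ({z : EuclideanSpace ℝ (Fin 6) | ∑ i : Fin 5, z (Fin.castSucc i) ^ 2 = 1 ∧ z 5 = 0} ∩ {y : EuclideanSpace ℝ (Fin 6) | t < F (Real.sqrt (Real.arccos (∑ i : Fin 5, y (Fin.castSucc i) * (EuclideanSpace.single 0 1 : EuclideanSpace ℝ (Fin 6)) (Fin.castSucc i)) ^ 2 + (y 5 - (EuclideanSpace.single 0 1 : EuclideanSpace ℝ (Fin 6)) 5) ^ 2))})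
/-- Alias keyed by the registered stub name. -/
abbrev stub_layerCakeCore : Prop :=
    ∀ (τ : ℝ) (Λ : ℝ≥0∞) (S : Set (EuclideanSpace ℝ (Fin 6))) (F : ℝ → ℝ) (p : EuclideanSpace ℝ (Fin 6)),
      (∀ y ∈ S, ∑ i : Fin 5, y (Fin.castSucc i) ^ 2 = 1) →
      Antitone F → (∀ r : ℝ, 0 ≤ F r) → ∑ i : Fin 5, p (Fin.castSucc i) ^ 2 = 1 →
      (∀ y : EuclideanSpace ℝ (Fin 6), ∑ i : Fin 5, y (Fin.castSucc i) ^ 2 = 1 → cylKernel p τ y ≤ F (Real.sqrt (Real.arccos (∑ i : Fin 5, y (Fin.castSucc i) * p (Fin.castSucc i)) ^ 2 + (y 5 - p 5) ^ 2))) →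
      (∀ y : EuclideanSpace ℝ (Fin 6), ∑ i : Fin 5, y (Fin.castSucc i) ^ 2 = 1 → y 5 = 0 →
            ENNReal.ofReal (F (Real.sqrt (Real.arccos (∑ i : Fin 5, y (Fin.castSucc i) * (EuclideanSpace.single 0 1 : EuclideanSpace ℝ (Fin 6)) (Fin.castSucc i)) ^ 2 + (y 5 - (EuclideanSpace.single 0 1 : EuclideanSpace ℝ (Fin 6)) 5) ^ 2))) ≤
              ENNReal.ofReal (cylKernel (EuclideanSpace.single 0 1 : EuclideanSpace ℝ (Fin 6)) τ y)) →
      (∀ t : ℝ, 0 < t →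
          μH[4] (S ∩ {y : EuclideanSpace ℝ (Fin 6) | t < F (Real.sqrt (Real.arccos (∑ i : Fin 5, y (Fin.castSucc i) * p (Fin.castSucc i)) ^ 2 + (y 5 - p 5) ^ 2))}) ≤
            Λ * μH[4] ({z : EuclideanSpace ℝ (Fin 6) | ∑ i : Fin 5, z (Fin.castSucc i) ^ 2 = 1 ∧ z 5 = 0} ∩ {y : EuclideanSpace ℝ (Fin 6) | t < F (Real.sqrt (Real.arccos (∑ i : Fin 5, y (Fin.castSucc i) * (EuclideanSpace.single 0 1 : EuclideanSpace ℝ (Fin 6)) (Fin.castSucc i)) ^ 2 + (y 5 - (EuclideanSpace.single 0 1 : EuclideanSpace ℝ (Fin 6)) 5) ^ 2))})) →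
        cylDensity S p τ ≤ Λ * cylDensity {z : EuclideanSpace ℝ (Fin 6) | ∑ i : Fin 5, z (Fin.castSucc i) ^ 2 = 1 ∧ z 5 = 0} (EuclideanSpace.single 0 1 : EuclideanSpace ℝ (Fin 6)) τ
/-- Alias keyed by the registered stub name. -/
abbrev stub_massSlackIntr : Prop :=
    ∀ (M : Type) [TopologicalSpace M] [T2Space M] [SecondCountableTopology M]
      [ChartedSpace (EuclideanSpace ℝ (Fin 4)) M] [IsManifold (𝓡 4) ∞ M],
      M ≃ₕ (Metric.sphere (0 : EuclideanSpace ℝ (Fin 5)) 1) →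
      ∃ ι : M → EuclideanSpace ℝ (Fin 6), Manifold.IsSmoothEmbedding (𝓡 4) (𝓡 6) ∞ ι ∧
        (∀ x, ∑ i : Fin 5, ι x (Fin.castSucc i) ^ 2 = 1) ∧
        (∃ R : ℝ, ∀ a b : EuclideanSpace ℝ (Fin 6), ∑ i : Fin 5, a (Fin.castSucc i) ^ 2 = 1 → ∑ i : Fin 5, b (Fin.castSucc i) ^ 2 = 1 → a 5 ≤ -R → R ≤ b 5 →
          ¬ JoinedIn ({z : EuclideanSpace ℝ (Fin 6) | ∑ i : Fin 5, z (Fin.castSucc i) ^ 2 = 1} \ Set.range ι) a b) ∧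
        ∃ Λ : ℝ≥0∞, Λ < ENNReal.ofReal (4 / Real.exp 1) ∧
          ∀ p : EuclideanSpace ℝ (Fin 6), ∑ i : Fin 5, p (Fin.castSucc i) ^ 2 = 1 → ∀ r : ℝ, 0 < r →
          μH[4] (Set.range ι ∩ {y : EuclideanSpace ℝ (Fin 6) | ∑ i : Fin 5, y (Fin.castSucc i) ^ 2 = 1 ∧ Real.arccos (∑ i : Fin 5, y (Fin.castSucc i) * p (Fin.castSucc i)) ^ 2 + (y 5 - p 5) ^ 2 ≤ r ^ 2}) ≤
            Λ * μH[4] ({z : EuclideanSpace ℝ (Fin 6) | ∑ i : Fin 5, z (Fin.castSucc i) ^ 2 = 1 ∧ z 5 = 0} ∩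
              {y : EuclideanSpace ℝ (Fin 6) | ∑ i : Fin 5, y (Fin.castSucc i) ^ 2 = 1 ∧ Real.arccos (∑ i : Fin 5, y (Fin.castSucc i) * (EuclideanSpace.single 0 1 : EuclideanSpace ℝ (Fin 6)) (Fin.castSucc i)) ^ 2 + (y 5 - (EuclideanSpace.single 0 1 : EuclideanSpace ℝ (Fin 6)) 5) ^ 2 ≤ r ^ 2})

end Registered

/-! ## §4 The composition: the seven stubs (+ item 7634) imply the crux, BY NAME -/

/-- **`ThinCrossSectionExists` from the seven stubs and the route's calibration item** (pure logic plus the §3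
glue; no `sorry`): D supplies, for each homotopy 4-sphere, a smooth end-separating cross-section with
`Λ`-subspherical intrinsic ball mass for some `Λ < 4/e`; H, A', B, C-dom, C-level, C-core with `SliceCalibration`
give `λ_cyl ≤ Λ < 4/e` for ITS OWN image.  No diffeomorphism `M ≅ S⁴` is formed; `SmoothPoincare4` is not upstream. -/
theorem ThinCrossSectionExists_of (hH : Registered.stub_hamiltonConvex)
    (hA : Registered.stub_harnackRadial_of_convex) (hB : Registered.stub_zonalMonotone)
    (hCd : Registered.stub_kernelDomination) (hCl : Registered.stub_levelComparison)
    (hCc : Registered.stub_layerCakeCore) (hD : Registered.stub_massSlackIntr)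
    (hcal : SliceCalibration) : ThinCrossSectionExists := by
  rw [crux_iff]
  intro M _ _ _ _ _ e
  obtain ⟨ι, hι, hN, hsep, Λ, hΛ, hmass⟩ := hD M e
  have hS : ∀ y ∈ Set.range ι, InN y := by
    rintro _ ⟨x, rfl⟩
    exact hN x
  have h1 : cylEntropy slice₀ = 1 := sliceCalibration_iff.mp hcal
  refine ⟨ι, hι, hN, hsep, ?_⟩
  show (⨆ (p : E⁶) (_ : ∑ i : Fin 5, p (Fin.castSucc i) ^ 2 = 1) (τ : ℝ) (_ : 0 < τ),
    cylDensity (Set.range ι) p τ) < level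
  refine lt_of_le_of_lt (iSup₂_le fun p hp => iSup₂_le fun τ hτ => ?_) hΛ
  obtain ⟨F, hFa, hF0, hdom, hex⟩ := hCd (hA hH) hB τ hτ
  calc cylDensity (Set.range ι) p τ ≤ Λ * cylDensity slice₀ e₀ τ :=
        hCc τ Λ (Set.range ι) F p hS hFa hF0 hp (fun y hy => hdom p y hp hy) hex
          (fun t _ => hCl Λ (Set.range ι) F p t hS hmass hFa hp)
    _ ≤ Λ * cylEntropy slice₀ := by
        gcongr
        exact le_iSup_of_le e₀ (le_iSup_of_le inN_e₀ (le_iSup_of_le τ (le_iSup_of_le hτ le_rfl)))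
    _ = Λ := by rw [h1, mul_one]

/-- Wiring check: the registered stubs feed `ThinCrossSectionExists_of` as stated. -/
example (hcal : SliceCalibration) : ThinCrossSectionExists :=
  ThinCrossSectionExists_of stub_hamiltonConvex stub_harnackRadial_of_convex stub_zonalMonotone
    stub_kernelDomination stub_levelComparison stub_layerCakeCore stub_massSlackIntr hcal

/-! ## §5 R-side corollary (proved from the stubs): mass-pinching rigidity in the cylinder -/

/-- **`massRigid`** — given the recognition crux R (`CylinderRungTwo`, item 7631), H, A', B, C-* and the calibration:
a homotopy 4-sphere realised in `N` by a smooth end-separating embedding whose image has `Λ`-subspherical intrinsic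
ball mass for some `Λ < 4/e` is diffeomorphic to `S⁴`.  This is the only way `D ⇒ SPC4` is known. -/
theorem massRigid (hR : CylinderRungTwo) (hA : HarnackRadial) (hB : ZonalMonotone) (hcal : SliceCalibration)
    (M : Type) [TopologicalSpace M] [T2Space M] [SecondCountableTopology M]
    [ChartedSpace E⁴ M] [IsManifold (𝓡 4) ∞ M] (e : M ≃ₕ 𝕊⁴)
    (ι : M → E⁶) (hι : Manifold.IsSmoothEmbedding (𝓡 4) (𝓡 6) ∞ ι) (hN : ∀ x, InN (ι x))
    (hsep : Separates (Set.range ι)) {Λ : ℝ≥0∞} (hΛ : Λ < level)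
    (hmass : SubsphericalMassIntr Λ (Set.range ι)) :
    Nonempty (M ≃ₘ⟮𝓡 4, 𝓡 4⟯ 𝕊⁴) := by
  have hS : ∀ y ∈ Set.range ι, InN y := by
    rintro _ ⟨x, rfl⟩
    exact hN x
  have hthin : cylEntropy (Set.range ι) < level := cylEntropy_lt_level_of_subspherical hA hB hcal hΛ hS hmass
  obtain ⟨R, hR'⟩ := hsep
  exact hR M e ι hι hN ⟨R, hR'⟩ hthin

end Summit.SmoothPoincare4.SmoothPoincare4.Cruxes.ThinCrossSectionExists.BallMassSlack

end
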